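import Mathlib
import Summits.Ventures.LatticeQCDFlow.TrivializingMaps.WilsonGradientBound
import Summits.Ventures.LatticeQCDFlow.TrivializingMaps.SlotCoefficient
import Summits.Ventures.LatticeQCDFlow.TrivializingMaps.SlotFunctions
import Literature.MathematicalPhysics.QuantumLattice.HubbardInteractionMoments

/-!
# The Wilson action as slot coefficient functions (THEORY-1 §19.1, file (5b))

HONEST FRAMING. Exact (Metropolis-corrected) sampling algorithms for lattice gauge theory; figures of
merit are autocorrelation/cost numbers at stated couplings and volumes; no continuum-physics claim.
This file is index bookkeeping for the Wilson plaquette action; no analysis, no physics.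

The plaquette `Re tr(1 - W₀ W₁ W₂ᴴ W₃ᴴ)` (`WilsonPolynomials.plaqRe`, links `W_i = W (plaqIdx x μ ν i)`)
is `n` minus the slot coefficient function (`SlotCoefficient.coeff`) of the FOUR-SLOT system
`(plaqIdx x μ ν, plaqPol)` with polarities `(+,+,-,-)` and the explicit `{0,1}`-valued kernel `plaqKer n`
(`plaqRe_eq_sub_coeff`): `tr(W₀W₁W₂ᴴW₃ᴴ) = ∑_{i,l,k,j} R_σ(W)_{(i,j,l,i),(j,k,k,l)}` (`coeffC_plaqKer`).
Hence the Wilson action is, EXACTLY and on all of the ambient space, a constant minus a finite sum of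
coefficient functions (`ambWilsonAction_eq`), and by `SlotCoefficient.linkDeriv_coeff` its link
derivatives — the vertex factors `∂_{e,Y} S_W` of Lüscher's recursion (4.15) — are again coefficient
functions of the same four-slot systems with contracted kernels (`linkDeriv_ambWilsonAction`).
Coefficient functions on the lattice are smooth (`contDiff_coeff`).
[cite: Luscher2010Trivializing, §4.4 eq. (4.16), §4.3 eq. (4.15)] for the objects; the bookkeeping is ours.
-/

noncomputable section

namespace Summit.Ventures.LatticeQCDFlow.TrivializingMaps.PlaquetteData

open scoped ComplexConjugate Matrix Matrix.Norms.Frobenius ContDiff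
open Finset
open Literature.MathematicalPhysics.QuantumFieldTheory
open Literature.MathematicalPhysics.QuantumFieldTheory.Luscher2010
open SlotRepresentation SlotCasimir SlotCoefficient

variable {d L n : ℕ}

/-! ## 1. Smoothness and elementary kernels -/

section General

variable {σ : Type*} [Fintype σ] [DecidableEq σ]

/-- Complex coefficient functions on the lattice are smooth (`L ≥ 1`, so that the lattice is finite).
[folklore] -/
theorem contDiff_coeffC [NeZero L] (lnk : σ → Edge d L) (pol : σ → Bool) (a : Kernel σ n) :
    ContDiff ℝ ∞ (coeffC lnk pol a : AmbConfig d L n → ℂ) := by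
  show ContDiff ℝ ∞ fun W : AmbConfig d L n => ∑ I, ∑ J, a I J * slotRep lnk pol W I J
  exact ContDiff.sum fun I _ => ContDiff.sum fun J _ =>
    contDiff_const.mul (SlotFunctions.contDiff_slotRep_apply lnk pol I J)

/-- Coefficient functions on the lattice are smooth. [folklore] -/
theorem contDiff_coeff [NeZero L] (lnk : σ → Edge d L) (pol : σ → Bool) (a : Kernel σ n) :
    ContDiff ℝ ∞ (coeff lnk pol a : AmbConfig d L n → ℝ) := by
  show ContDiff ℝ ∞ fun W : AmbConfig d L n => (coeffC lnk pol a W).re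
  exact Complex.reCLM.contDiff.comp (contDiff_coeffC lnk pol a)

/-- The elementary kernel `δ_{I I₀} δ_{J J₀}`. [folklore] -/
def elemKer (I₀ J₀ : σ → Fin n) : Kernel σ n := fun I J => if I = I₀ ∧ J = J₀ then 1 else 0

/-- The coefficient function of an elementary kernel is the matrix entry `R_σ(W)_{I₀J₀}`. [folklore] -/
theorem coeffC_elemKer (lnk : σ → Edge d L) (pol : σ → Bool) (I₀ J₀ : σ → Fin n)
    (W : AmbConfig d L n) : coeffC lnk pol (elemKer I₀ J₀) W = slotRep lnk pol W I₀ J₀ := by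
  simp [coeffC, elemKer, ite_and]

/-- Link derivative of `W ↦ c - f W`. [folklore] -/
theorem linkDeriv_const_sub (e : Edge d L) (X : Matrix (Fin n) (Fin n) ℂ) (c : ℝ)
    (f : AmbConfig d L n → ℝ) (W : AmbConfig d L n) :
    linkDeriv e X (fun W' => c - f W') W = -linkDeriv e X f W := by
  unfold linkDeriv
  exact deriv_const_sub c

end General

/-! ## 2. The plaquette as a four-slot coefficient function -/

/-- Polarities of the four plaquette slots: `W, W, W̄, W̄`. [folklore] -/
def plaqPol : Fin 4 → Bool := ![true, true, false, false]

/-- Values of `plaqPol`. [folklore] -/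
@[simp] theorem plaqPol_zero : plaqPol 0 = true := rfl
/-- Values of `plaqPol`. [folklore] -/
@[simp] theorem plaqPol_one : plaqPol 1 = true := rfl
/-- Values of `plaqPol`. [folklore] -/
@[simp] theorem plaqPol_two : plaqPol 2 = false := rfl
/-- Values of `plaqPol`. [folklore] -/
@[simp] theorem plaqPol_three : plaqPol 3 = false := rfl

-- Entries of a four-vector `![a, b, c, e] i`: the tree's `vecCons_four_apply_*`
-- (`Literature/MathematicalPhysics/QuantumLattice/HubbardInteractionMoments.lean`), used as `simp` lemmas here
-- and downstream (landing note: replaces the duplicate local copies `vec4_*` of the HOME bytes).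
attribute [simp] Literature.MathematicalPhysics.QuantumLattice.vecCons_four_apply_zero
  Literature.MathematicalPhysics.QuantumLattice.vecCons_four_apply_one
  Literature.MathematicalPhysics.QuantumLattice.vecCons_four_apply_two
  Literature.MathematicalPhysics.QuantumLattice.vecCons_four_apply_three

/-- Bra multi-index of the trace term `(i, l, k, j)`: `(i, j, l, i)`. [folklore] -/
def braIdx (c : Fin n × Fin n × Fin n × Fin n) : Fin 4 → Fin n := ![c.1, c.2.2.2, c.2.1, c.1]

/-- Ket multi-index of the trace term `(i, l, k, j)`: `(j, k, k, l)`. [folklore] -/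
def ketIdx (c : Fin n × Fin n × Fin n × Fin n) : Fin 4 → Fin n := ![c.2.2.2, c.2.2.1, c.2.2.1, c.2.1]

/-- **The plaquette kernel**: the sum of the elementary kernels of the trace terms. [folklore] -/
def plaqKer (n : ℕ) : Kernel (Fin 4) n := ∑ c : Fin n × Fin n × Fin n × Fin n, elemKer (braIdx c) (ketIdx c)

/-- One trace term is one entry of the slot representation. [folklore] -/
theorem slotRep_braIdx_ketIdx (lnk : Fin 4 → Edge d L) (W : AmbConfig d L n)
    (i l k j : Fin n) :
    slotRep lnk plaqPol W (braIdx (i, l, k, j)) (ketIdx (i, l, k, j)) =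
      W (lnk 0) i j * W (lnk 1) j k * star (W (lnk 2) l k) * star (W (lnk 3) i l) := by
  simp [slotRep, kronPi_apply, Fin.prod_univ_four, braIdx, ketIdx]

/-- **`tr(W₀W₁W₂ᴴW₃ᴴ)` is the coefficient function of the plaquette kernel.**
[cite: Luscher2010Trivializing, §4.4 eq. (4.16)] -/
theorem coeffC_plaqKer (lnk : Fin 4 → Edge d L) (W : AmbConfig d L n) :
    coeffC lnk plaqPol (plaqKer n) W =
      (W (lnk 0) * W (lnk 1) * (W (lnk 2))ᴴ * (W (lnk 3))ᴴ).trace := by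
  rw [plaqKer, coeffC_sum]
  simp only [coeffC_elemKer, Fintype.sum_prod_type, slotRep_braIdx_ketIdx]
  simp only [Matrix.trace, Matrix.diag_apply, Matrix.mul_apply, Matrix.conjTranspose_apply,
    Finset.sum_mul]

/-- **The plaquette is `n` minus a four-slot coefficient function**, on all of the ambient space.
[cite: Luscher2010Trivializing, §4.4 eq. (4.16)] -/
theorem plaqRe_eq_sub_coeff (x : Site d L) (μ ν : Fin d) (W : AmbConfig d L n) :
    plaqRe x μ ν W = n - coeff (plaqIdx x μ ν) plaqPol (plaqKer n) W := by
  show ((1 : Matrix (Fin n) (Fin n) ℂ) - _).trace.re = (n : ℝ) - (coeffC (plaqIdx x μ ν) plaqPol (plaqKer n) W).re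
  rw [coeffC_plaqKer, Matrix.trace_sub, Matrix.trace_one, Complex.sub_re]
  simp [plaqIdx]

variable [NeZero L]

/-- **The Wilson action as coefficient functions**: `S_W = ∑_{x, μ<ν} (n - coeff_{σ_p}(a_p))` exactly.
[cite: Luscher2010Trivializing, §4.4 eq. (4.16)] -/
theorem ambWilsonAction_eq (W : AmbConfig d L n) :
    ambWilsonAction W = ∑ p : Site d L × Fin d × Fin d,
      if p.2.1 < p.2.2 then (n : ℝ) - coeff (plaqIdx p.1 p.2.1 p.2.2) plaqPol (plaqKer n) W else 0 := by
  have h := congrFun (ambWilsonAction_eq_sum_plaqTerm (d := d) (L := L) (n := n)) W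
  rw [h]
  refine Finset.sum_congr rfl fun p _ => ?_
  by_cases hp : p.2.1 < p.2.2
  · rw [plaqTerm_of_lt hp, if_pos hp, plaqRe_eq_sub_coeff]
  · rw [plaqTerm_of_not_lt hp, if_neg hp]

/-- **The vertex factors are coefficient functions**: `∂_{e,Y} S_W = -∑_{x, μ<ν} coeff_{σ_p}(a_p ⋆ Y^{σ_p,e})`
on all of the ambient space, for every `Y`. [cite: Luscher2010Trivializing, §4.3 eq. (4.15)] -/
theorem linkDeriv_ambWilsonAction (e : Edge d L) (Y : Matrix (Fin n) (Fin n) ℂ) (W : AmbConfig d L n) :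
    linkDeriv e Y (ambWilsonAction : AmbConfig d L n → ℝ) W =
      -∑ p : Site d L × Fin d × Fin d, if p.2.1 < p.2.2 then
        coeff (plaqIdx p.1 p.2.1 p.2.2) plaqPol
          (contract (plaqKer n) (slotGen (plaqIdx p.1 p.2.1 p.2.2) plaqPol e Y)) W else 0 := by
  rw [ambWilsonAction_eq_sum_plaqTerm,
    linkDeriv_finset_sum e Y Finset.univ (fun p : Site d L × Fin d × Fin d => plaqTerm p)
      (fun p _ => contDiff_plaqTerm p)]
  rw [← Finset.sum_neg_distrib]
  refine Finset.sum_congr rfl fun p _ => ?_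
  by_cases hp : p.2.1 < p.2.2
  · have hfun : plaqTerm (n := n) p =
        fun W' => (n : ℝ) - coeff (plaqIdx p.1 p.2.1 p.2.2) plaqPol (plaqKer n) W' := by
      rw [plaqTerm_of_lt hp]; funext W'; exact plaqRe_eq_sub_coeff _ _ _ W'
    rw [hfun, if_pos hp, linkDeriv_const_sub, linkDeriv_coeff]
  · rw [plaqTerm_of_not_lt hp, if_neg hp, neg_zero]
    unfold linkDeriv
    exact deriv_const (0 : ℝ) (0 : ℝ)

/-- The vertex factors are smooth. [folklore] -/
theorem contDiff_linkDeriv_ambWilsonAction (e : Edge d L) (Y : Matrix (Fin n) (Fin n) ℂ) :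
    ContDiff ℝ ∞ (linkDeriv e Y (ambWilsonAction : AmbConfig d L n → ℝ)) := by
  have hfun : linkDeriv e Y (ambWilsonAction : AmbConfig d L n → ℝ) = fun W =>
      -∑ p : Site d L × Fin d × Fin d, if p.2.1 < p.2.2 then
        coeff (plaqIdx p.1 p.2.1 p.2.2) plaqPol
          (contract (plaqKer n) (slotGen (plaqIdx p.1 p.2.1 p.2.2) plaqPol e Y)) W else 0 :=
    funext fun W => linkDeriv_ambWilsonAction e Y W
  rw [hfun]
  refine ContDiff.neg (ContDiff.sum fun p _ => ?_)
  by_cases hp : p.2.1 < p.2.2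
  · simp only [if_pos hp]; exact contDiff_coeff (plaqIdx p.1 p.2.1 p.2.2) plaqPol _
  · simp only [if_neg hp]; exact contDiff_const

end Summit.Ventures.LatticeQCDFlow.TrivializingMaps.PlaquetteData
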